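import Literature.Probability.Distributions.QuantileCoupling
import Literature.Analysis.Calculus.AntitoneSquareIntegralComparison
import HarnessLib

/-!
# Second-moment bound from a concave tail constraint

Probability/Distributions support file (everything proved; no definitions, no named facts).

Main result `integral_sq_le_of_setIntegral_le_concave` (R. Bamler 2020a, §4.3: Claim 4.3 and the
end of the proof of Prop. 4.2). Let `q` be a bounded measurable function with `∫ q dν = 0` on a
probability space `(α, ν)`, and let `F` be continuous and concave on `[0, 1]` with
`F 0 = F 1 = 0`, differentiable on `(0, 1)` with derivative `F'`, `F'²` integrable on `[0, 1]`.
If the tail constraint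

  `∫_X q dν ≤ F (ν X)` for every measurable `X ⊆ α`

holds, then `∫ q² dν ≤ ∫₀¹ F'²`.

Proof. Let `h` be the decreasing rearrangement of `q` (`exists_antitone_map_volume_Ioo_eq_map`):
an antitone bounded function whose law under Lebesgue measure on `(0, 1)` is the law of `q`.
Transporting integrals along the equality of laws, `∫₀¹ h = 0`, `∫₀¹ h² = ∫ q² dν`, and the tail
constraint holds for `h` on all sets `h ⁻¹' B ∩ (0, 1)`. The primitive `H a = ∫₀ᵃ h` then
satisfies `H ≤ F` on `[0, 1]`
(`intervalIntegral_le_of_antitone_of_setIntegral_preimage_le`): for `a ∈ (0, 1)` and `b = h a`,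
monotonicity gives `S = {b < h} ∩ (0, 1) ⊆ (0, a] ⊆ S' = {b ≤ h} ∩ (0, 1)` with `h = b` on both
differences, so with `m = |S| ≤ a ≤ m' = |S'|`,

  `H a = ∫_S h + b (a - m)`, `∫_{S'} h = H a + b (m' - a)`,

whence `(m' - m) H a = (m' - a) ∫_S h + (a - m) ∫_{S'} h ≤ (m' - a) F m + (a - m) F m'
  ≤ (m' - m) F a` by the tail constraint and concavity of `F` (and `H a = ∫_S h ≤ F m = F a` if
`m = m'`). The conclusion is the real-variable comparison
`Literature.Analysis.Calculus.sq_integral_le_of_antitone_of_integral_le`.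

What is NOT here: the heat-kernel input (Bamler's two-set Gaussian concentration producing the
tail constraint with `F = Φ' ∘ Φ⁻¹`), the value `∫₀¹ F'² = 1/2` for that `F`, the cases `p ≠ 2`
of Prop. 4.2, and any equality discussion.

## References

* R. H. Bamler, *Entropy and heat kernel bounds on a Ricci flow background*, arXiv:2008.07093
  (2020), §4.3, Claim 4.3 and proof of Prop. 4.2. [Bamler2020Entropy]
-/

noncomputable section

namespace Literature.Probability.Distributions

open Set _root_.MeasureTheory _root_.ProbabilityTheory

/-- **Primitive of an antitone function under a concave tail constraint.** Let `h : ℝ → ℝ` be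
antitone and bounded, `F` concave on `[0, 1]`, and suppose
`∫_{h ⁻¹' B ∩ (0,1)} h ≤ F |h ⁻¹' B ∩ (0,1)|` for every measurable `B ⊆ ℝ`. Then `∫₀ᵃ h ≤ F a`
for every `a ∈ (0, 1)`.

With `b = h a`, `S = {b < h} ∩ (0, 1) ⊆ (0, a] ⊆ S' = {b ≤ h} ∩ (0, 1)` and `h = b` on
`(0, a] \ S` and on `S' \ (0, a]`; so `∫₀ᵃ h` is the convex combination of `∫_S h ≤ F |S|` and
`∫_{S'} h ≤ F |S'|` with the weights expressing `a` as a convex combination of `|S| ≤ a ≤ |S'|`.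
This is the step "`H ≤ F` on `[0, 1]`" in Bamler (2020a), §4.3, proof of Prop. 4.2, after
Claim 4.3. [folklore] -/
theorem intervalIntegral_le_of_antitone_of_setIntegral_preimage_le {h F : ℝ → ℝ}
    (hh : Antitone h) (hbdd : ∃ C : ℝ, ∀ a, |h a| ≤ C) (hconc : ConcaveOn ℝ (Icc (0 : ℝ) 1) F)
    (hle : ∀ B : Set ℝ, MeasurableSet B →
      ∫ x in h ⁻¹' B ∩ Ioo 0 1, h x ≤ F (volume.real (h ⁻¹' B ∩ Ioo 0 1)))
    {a : ℝ} (ha : a ∈ Ioo (0 : ℝ) 1) :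
    ∫ x in (0 : ℝ)..a, h x ≤ F a := by
  obtain ⟨C, hC⟩ := hbdd
  have hmeas : Measurable h := hh.measurable
  -- the bounded measurable `h` is integrable on sets of finite measure
  have hint : ∀ s : Set ℝ, volume s ≠ ⊤ → IntegrableOn h s volume := fun s hs =>
    Measure.integrableOn_of_bounded hs hmeas.aestronglyMeasurable
      (ae_of_all _ fun x => by rw [Real.norm_eq_abs]; exact hC x)
  -- tail constraint on the strict and the non-strict superlevel set at level `h a`
  have hP : ∫ x in h ⁻¹' Ioi (h a) ∩ Ioo 0 1, h x ≤ F (volume.real (h ⁻¹' Ioi (h a) ∩ Ioo 0 1)) :=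
    hle _ measurableSet_Ioi
  have hP' : ∫ x in h ⁻¹' Ici (h a) ∩ Ioo 0 1, h x ≤ F (volume.real (h ⁻¹' Ici (h a) ∩ Ioo 0 1)) :=
    hle _ measurableSet_Ici
  set S : Set ℝ := h ⁻¹' Ioi (h a) ∩ Ioo 0 1
  set S' : Set ℝ := h ⁻¹' Ici (h a) ∩ Ioo 0 1
  have hSm : MeasurableSet S := (hmeas measurableSet_Ioi).inter measurableSet_Ioo
  have hS'm : MeasurableSet S' := (hmeas measurableSet_Ici).inter measurableSet_Ioo
  have hS'fin : volume S' ≠ ⊤ :=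
    measure_ne_top_of_subset inter_subset_right measure_Ioo_lt_top.ne
  have hIfin : volume (Ioc 0 a) ≠ ⊤ := measure_Ioc_lt_top.ne
  -- `S ⊆ (0, a] ⊆ S'`, and `h = h a` on the two differences
  have hSI : S ⊆ Ioc 0 a := fun x hx =>
    ⟨hx.2.1, not_lt.1 fun hax => (hh hax.le).not_gt hx.1⟩
  have hIS' : Ioc 0 a ⊆ S' := fun x hx => ⟨hh hx.2, hx.1, hx.2.trans_lt ha.2⟩
  have hI_S : EqOn h (fun _ => h a) (Ioc 0 a \ S) := fun x hx =>
    le_antisymm (not_lt.1 fun hlt => hx.2 ⟨hlt, hx.1.1, hx.1.2.trans_lt ha.2⟩) (hh hx.1.2)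
  have hS'_I : EqOn h (fun _ => h a) (S' \ Ioc 0 a) := fun x hx =>
    le_antisymm (hh (not_le.1 fun hxa => hx.2 ⟨hx.1.2.1, hxa⟩).le) hx.1.1
  -- measures
  have hmI : volume.real (Ioc 0 a) = a := by
    rw [Real.volume_real_Ioc_of_le ha.1.le, sub_zero]
  have hm_le : volume.real S ≤ a := by
    have := measureReal_mono (μ := volume) hSI hIfin
    rwa [hmI] at this
  have hle_m' : a ≤ volume.real S' := by
    have := measureReal_mono (μ := volume) hIS' hS'fin
    rwa [hmI] at this
  have hm'1 : volume.real S' ≤ 1 := by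
    calc volume.real S' ≤ volume.real (Ioo (0 : ℝ) 1) :=
          measureReal_mono inter_subset_right measure_Ioo_lt_top.ne
      _ = 1 := by rw [Real.volume_real_Ioo_of_le zero_le_one, sub_zero]
  have hm0 : 0 ≤ volume.real S := measureReal_nonneg
  -- integrals
  have h1 : ∫ x in Ioc 0 a, h x = (∫ x in S, h x) + h a * (a - volume.real S) := by
    have hdiff := setIntegral_sdiff hSm (hint _ hIfin) hSI
    rw [setIntegral_congr_fun (measurableSet_Ioc.diff hSm) hI_S, setIntegral_const,
      measureReal_sdiff hSI hSm hIfin, hmI, smul_eq_mul] at hdiff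
    linear_combination (-1 : ℝ) * hdiff
  have h2 : ∫ x in S', h x = (∫ x in Ioc 0 a, h x) + h a * (volume.real S' - a) := by
    have hdiff := setIntegral_sdiff measurableSet_Ioc (hint _ hS'fin) hIS'
    rw [setIntegral_congr_fun (hS'm.diff measurableSet_Ioc) hS'_I, setIntegral_const,
      measureReal_sdiff hIS' measurableSet_Ioc hS'fin, hmI, smul_eq_mul] at hdiff
    linear_combination (-1 : ℝ) * hdiff
  rw [intervalIntegral.integral_of_le ha.1.le]
  set m := volume.real S
  set m' := volume.real S'
  set P := ∫ x in S, h x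
  set P' := ∫ x in S', h x
  set H := ∫ x in Ioc 0 a, h x
  rcases (hm_le.trans hle_m').eq_or_lt with heq | hlt
  · -- degenerate case `|S| = a = |S'|`
    have hma : m = a := le_antisymm hm_le (hle_m'.trans heq.ge)
    calc H = P := by rw [h1, hma, sub_self, mul_zero, add_zero]
      _ ≤ F m := hP
      _ = F a := by rw [hma]
  · have hd : 0 < m' - m := sub_pos.2 hlt
    have hmI01 : m ∈ Icc (0 : ℝ) 1 := ⟨hm0, hm_le.trans ha.2.le⟩
    have hm'I01 : m' ∈ Icc (0 : ℝ) 1 := ⟨hm0.trans hlt.le, hm'1⟩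
    -- concavity of `F` at `a = ((m' - a) m + (a - m) m') / (m' - m)`
    have hcv := hconc.2 hmI01 hm'I01 (div_nonneg (sub_nonneg.2 hle_m') hd.le)
      (div_nonneg (sub_nonneg.2 hm_le) hd.le)
      (show (m' - a) / (m' - m) + (a - m) / (m' - m) = 1 by
        rw [← add_div, div_eq_one_iff_eq hd.ne']; ring)
    have hcomb : ((m' - a) / (m' - m)) • m + ((a - m) / (m' - m)) • m' = a := by
      rw [smul_eq_mul, smul_eq_mul, div_mul_eq_mul_div, div_mul_eq_mul_div, ← add_div,
        div_eq_iff hd.ne']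
      ring
    rw [hcomb, smul_eq_mul, smul_eq_mul] at hcv
    have hcv' : (m' - a) * F m + (a - m) * F m' ≤ F a * (m' - m) := by
      rw [← div_le_iff₀ hd]
      convert hcv using 1
      ring
    have key : H * (m' - m) ≤ F a * (m' - m) :=
      calc H * (m' - m) = (m' - a) * P + (a - m) * P' := by
            linear_combination (m' - a) * h1 - (a - m) * h2
        _ ≤ (m' - a) * F m + (a - m) * F m' :=
            add_le_add (mul_le_mul_of_nonneg_left hP (sub_nonneg.2 hle_m'))
              (mul_le_mul_of_nonneg_left hP' (sub_nonneg.2 hm_le))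
        _ ≤ F a * (m' - m) := hcv'
    exact le_of_mul_le_mul_right key hd

/-- **Second-moment bound from a concave tail constraint** (Bamler 2020a, Claim 4.3 and the end
of the proof of Prop. 4.2). On a probability space `(α, ν)` let `q` be bounded and measurable with
`∫ q dν = 0`, and let `F` be continuous and concave on `[0, 1]` with `F 0 = F 1 = 0`, with
derivative `F'` on `(0, 1)` and `F'²` integrable on `[0, 1]`. If `∫_X q dν ≤ F (ν X)` for every
measurable set `X`, then `∫ q² dν ≤ ∫₀¹ F'²`.

Proof: pass to the decreasing rearrangement `h` of `q` on `(0, 1)`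
(`exists_antitone_map_volume_Ioo_eq_map`), whose primitive is dominated by `F`
(`intervalIntegral_le_of_antitone_of_setIntegral_preimage_le`), and apply
`Literature.Analysis.Calculus.sq_integral_le_of_antitone_of_integral_le`.
[cite: Bamler2020Entropy, §4.3, Claim 4.3] -/
theorem integral_sq_le_of_setIntegral_le_concave {α : Type*} [MeasurableSpace α] (ν : Measure α)
    [IsProbabilityMeasure ν] {q : α → ℝ} (hq : Measurable q) (hbdd : ∃ C : ℝ, ∀ y, |q y| ≤ C)
    (hq0 : ∫ y, q y ∂ν = 0) (F F' : ℝ → ℝ) (hF : ContinuousOn F (Icc 0 1)) (hF0 : F 0 = 0)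
    (hF1 : F 1 = 0) (hconc : ConcaveOn ℝ (Icc (0 : ℝ) 1) F)
    (hder : ∀ a ∈ Ioo (0 : ℝ) 1, HasDerivAt F (F' a) a)
    (hF'sq : IntervalIntegrable (fun a ↦ F' a ^ 2) volume 0 1)
    (htail : ∀ X : Set α, MeasurableSet X → ∫ y in X, q y ∂ν ≤ F (ν.real X)) :
    ∫ y, q y ^ 2 ∂ν ≤ ∫ a in (0 : ℝ)..1, F' a ^ 2 := by
  obtain ⟨h, hh, hhbdd, hmap⟩ := exists_antitone_map_volume_Ioo_eq_map ν hq hbdd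
  have hmeas : Measurable h := hh.measurable
  -- transport of integrals along the equality of laws
  have htrans : ∀ f : ℝ → ℝ, Measurable f →
      ∫ a in Ioo (0 : ℝ) 1, f (h a) = ∫ y, f (q y) ∂ν := fun f hf => by
    have e1 : ∫ y, f y ∂(volume.restrict (Ioo (0 : ℝ) 1)).map h = ∫ a in Ioo (0 : ℝ) 1, f (h a) :=
      integral_map hmeas.aemeasurable hf.aestronglyMeasurable
    have e2 : ∫ y, f y ∂ν.map q = ∫ y, f (q y) ∂ν :=
      integral_map hq.aemeasurable hf.aestronglyMeasurable
    rw [← e1, ← e2, hmap]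
  have hset : ∀ B : Set ℝ, MeasurableSet B →
      ∫ a in h ⁻¹' B ∩ Ioo 0 1, h a = ∫ y in q ⁻¹' B, q y ∂ν := fun B hB => by
    have e1 : ∫ y in B, y ∂(volume.restrict (Ioo (0 : ℝ) 1)).map h =
        ∫ a in h ⁻¹' B, h a ∂(volume.restrict (Ioo (0 : ℝ) 1)) :=
      setIntegral_map hB measurable_id.aestronglyMeasurable hmeas.aemeasurable
    have e2 : ∫ y in B, y ∂ν.map q = ∫ y in q ⁻¹' B, q y ∂ν :=
      setIntegral_map hB measurable_id.aestronglyMeasurable hq.aemeasurable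
    rw [Measure.restrict_restrict (hmeas hB)] at e1
    rw [← e1, ← e2, hmap]
  have hreal : ∀ B : Set ℝ, MeasurableSet B →
      volume.real (h ⁻¹' B ∩ Ioo 0 1) = ν.real (q ⁻¹' B) := fun B hB => by
    have e : (volume.restrict (Ioo (0 : ℝ) 1)).map h B = ν.map q B := by rw [hmap]
    rw [Measure.map_apply hmeas hB, Measure.map_apply hq hB,
      Measure.restrict_apply (hmeas hB)] at e
    simp only [measureReal_def, e]
  have hIoo : ∀ f : ℝ → ℝ, ∫ a in (0 : ℝ)..1, f a = ∫ a in Ioo (0 : ℝ) 1, f a := fun f => by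
    rw [intervalIntegral.integral_of_le zero_le_one, integral_Ioc_eq_integral_Ioo]
  have hint0 : ∫ a in Ioo (0 : ℝ) 1, h a = 0 := by
    have e : ∫ a in Ioo (0 : ℝ) 1, h a = ∫ y, q y ∂ν := htrans (fun y => y) measurable_id
    rw [e, hq0]
  have hsq : ∫ a in Ioo (0 : ℝ) 1, h a ^ 2 = ∫ y, q y ^ 2 ∂ν :=
    htrans (fun y => y ^ 2) (measurable_id'.pow_const 2)
  -- the primitive of `h` is dominated by `F`
  have hH : ∀ a ∈ Icc (0 : ℝ) 1, ∫ x in (0 : ℝ)..a, h x ≤ F a := by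
    intro a ha
    rcases ha.1.eq_or_lt with rfl | ha0
    · rw [intervalIntegral.integral_same, hF0]
    rcases ha.2.eq_or_lt with rfl | ha1
    · rw [hIoo, hint0, hF1]
    exact intervalIntegral_le_of_antitone_of_setIntegral_preimage_le hh hhbdd hconc
      (fun B hB => by rw [hset B hB, hreal B hB]; exact htail _ (hq hB)) ⟨ha0, ha1⟩
  calc ∫ y, q y ^ 2 ∂ν = ∫ a in (0 : ℝ)..1, h a ^ 2 := by rw [hIoo, hsq]
    _ ≤ ∫ a in (0 : ℝ)..1, F' a ^ 2 :=
      Literature.Analysis.Calculus.sq_integral_le_of_antitone_of_integral_le F F' h hF hF0 hF1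
        hder hF'sq hh hhbdd (by rw [hIoo, hint0]) hH

end Literature.Probability.Distributions
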